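import Literature.Algebra.Polynomial.LaguerreRootBound
import Summits.Ventures.HSemireg.WedgeHankelRecurrenceGaussMarkovStieltjesDistance

/-!
# Venture HSemireg — **VIETA FOR THE RECURRENCE; TRACE AND DETERMINANT OF THE JACOBI MATRIX**: for `q_0 = 1`, `q_1 = X − a_0`, `q_{k+2} = (X − a_{k+1}) q_{k+1} − b_{k+1} q_k`: the second
# coefficient of `q_{m+1}` is `−(a_0 + ⋯ + a_m)` and `c_1² − 2c_2 = Σ_{i≤m+1} a_i² + 2 Σ_{1≤i≤m+1} b_i` for `q_{m+2}`; hence, when `q_{m+1} = ∏_k (X − z_k)`, `Σ_k z_k = Σ_i a_i = tr J_m`,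
# `Σ_k z_k² = Σ_i a_i² + 2 Σ_i b_i = tr J_m²`, and `∏_k z_k = det J_m = (−1)^{m+1} q_{m+1}(0)` (`J_m` the Jacobi matrix of N293)

HONEST FRAMING. Part of the Lean index of the computation cell `pub-hsemireg` (seat p10 gen 43, Sunday typer «UNIFORM-IN-n»).  Real polynomials, their coefficients, finite sums and square real matrices
only; no variety, no cohomology theory, no sheaf, no Ext group and no semiregularity map is constructed here; nothing here says that HC / HC_CM / HC_AV holds; no Literature fact (unproved `Prop`) is
declared or used.  Custodian versions as in `WedgeHankelSiegelIdeal` (1/3).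
SOURCES (cited).  T. S. Chihara, *An Introduction to Orthogonal Polynomials* (1978), Ch. I §4, Ex. 4.4 and (4.13)–(4.14) (`Σ_k x_{nk} = Σ_{i<n} c_i`, `Σ_k x_{nk}² = Σ c_i² + 2 Σ λ_i`), Ch. IV §2
(Jacobi matrices); W. Gautschi, *Orthogonal Polynomials: Computation and Approximation* (2004), §1.3; G. H. Golub, J. H. Welsch, Math. Comp. 23 (1969) 221–230; F. Viète ∕ A. Girard (Newton
sums); the tree's `Literature/Algebra/Polynomial/LaguerreRootBound` (`Σ roots² = a_{n−1}² − 2 a_{n−2}`).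
PROOF TYPED HERE.  Coefficient recurrences `c_1(m+1) = c_1(m) − a_{m+1}`, `c_2(m+1) = c_2(m) − a_{m+2} c_1(m+1) − b_{m+2}` read off `(X − a) q − b q′` with Mathlib `coeff_X_mul`, `coeff_C_mul`;
induction; Vieta via Mathlib `Polynomial.roots_multiset_prod_X_sub_C` and the Literature lemma `sum_roots_sq_eq`; `tr J_m`, `tr J_m²` by the indicator-sum bookkeeping of N293; `det J_m` by Mathlib
`Matrix.det_eq_sign_charpoly_coeff` and N293 `charpoly_jacobi`.
DEDUP DISCLOSURE (`rg -n 'trace_jacobi|det_jacobi|coeff_recurrence|sum_recurrence_zeros' Summits Literature`, 2026-09-03): nothing for the recurrence ∕ Jacobi matrix; the Literature Laguerre file is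
cited by import.  The 9 names below: 0 hits tree-wide.

WHAT IS IN THE TREE.  N279 `recurrence_monic_natDegree`; N293 `charpoly_jacobi`; Literature `Algebra.Polynomial.LaguerreRootBound.sum_roots_sq_eq`; Mathlib `Polynomial.coeff_X_mul`, `coeff_C_mul`,
`coeff_eq_zero_of_natDegree_lt`, `Polynomial.roots_multiset_prod_X_sub_C`, `Finset.prod_eq_multiset_prod`, `Matrix.det_eq_sign_charpoly_coeff`, `Matrix.trace`, `Matrix.mul_apply`,
`Fin.sum_univ_eq_sum_range`, `Finset.sum_range_succ`, `Finset.sum_range_succ'`.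
THIS FILE (namespace `Summit.Ventures.HSemireg.Wedge.HankelOuter` continued; CHAINED on N297 (import), N279, N293; PLAIN on Literature `LaguerreRootBound`; 0 definitions):
* §1063 `coeff_recurrence_sub_one` (`[X^m] q_{m+1} = −Σ_{i≤m} a_i`), `coeff_recurrence_newton_two` (`c_1² − 2 c_2 = Σ_{i≤m+1} a_i² + 2 Σ_{i≤m} b_{i+1}` for `q_{m+2}`), `roots_prod_X_sub_C_fin` (the
  root multiset of `∏_{k : Fin n} (X − z_k)`), **`sum_recurrence_zeros`** (`Σ_k z_k = Σ_{i≤m} a_i`), **`sum_recurrence_zeros_sq`** (`Σ_k z_k² = Σ_{i≤m+1} a_i² + 2 Σ_{i≤m} b_{i+1}`), **`trace_jacobi`**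
  (`tr J_m = Σ_{i≤m} a_i`), **`trace_jacobi_sq`** (`tr J_m² = Σ_{i≤m} a_i² + 2 Σ_{i<m} b_{i+1}`), **`det_jacobi`** (`det J_m = (−1)^{m+1} q_{m+1}(0)`), `det_jacobi_eq_prod_zeros` (`det J_m = ∏_k z_k`,
  `tr J_m = Σ_k z_k`, `tr J_m² = Σ_k z_k²` when `q_{m+1} = ∏_k (X − z_k)`).
CAVEATS.  No positivity of `b` is needed anywhere in this file (the zeros are assumed given when they are mentioned).  Nothing Ext-side.  New names only.
-/

open Module Polynomial
open scoped Matrix Polynomial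

namespace Summit.Ventures.HSemireg.Wedge.HankelOuter

/-! ## §1063. Vieta for the recurrence; trace and determinant of the Jacobi matrix -/

/-- **`[X^m] q_{m+1} = −(a_0 + ⋯ + a_m)`.** [Chihara I Ex. 4.4 ∕ (4.13); this file, §1063] -/
theorem coeff_recurrence_sub_one {q : ℕ → ℝ[X]} {a b : ℕ → ℝ} (hq0 : q 0 = 1) (hq1 : q 1 = Polynomial.X - C (a 0))
    (hrec : ∀ n, q (n + 2) = (Polynomial.X - C (a (n + 1))) * q (n + 1) - C (b (n + 1)) * q n) :
    ∀ m, (q (m + 1)).coeff m = -∑ i ∈ Finset.range (m + 1), a i := by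
  intro m
  induction m with
  | zero => rw [zero_add, hq1, coeff_sub, coeff_X_zero, coeff_C_zero, Finset.sum_range_one]; ring
  | succ m ih =>
    have hmd := recurrence_monic_natDegree hq0 hq1 hrec
    have h1 : (q (m + 1)).coeff (m + 1) = 1 := by have := (hmd (m + 1)).1.coeff_natDegree; rwa [(hmd (m + 1)).2] at this
    have h0 : (q m).coeff (m + 1) = 0 := coeff_eq_zero_of_natDegree_lt (by rw [(hmd m).2]; omega)
    have h := hrec m
    rw [show m + 2 = m + 1 + 1 from rfl] at h
    rw [Finset.sum_range_succ a (m + 1), h, coeff_sub, sub_mul, coeff_sub, coeff_X_mul, coeff_C_mul, coeff_C_mul, ih, h1, h0]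
    ring

/-- **The second Newton sum from the coefficients**: with `c_1 = [X^{m+1}] q_{m+2}` and `c_2 = [X^m] q_{m+2}`, `c_1² − 2 c_2 = Σ_{i≤m+1} a_i² + 2 Σ_{i≤m} b_{i+1}`. [Chihara I (4.14); this file, §1063] -/
theorem coeff_recurrence_newton_two {q : ℕ → ℝ[X]} {a b : ℕ → ℝ} (hq0 : q 0 = 1) (hq1 : q 1 = Polynomial.X - C (a 0))
    (hrec : ∀ n, q (n + 2) = (Polynomial.X - C (a (n + 1))) * q (n + 1) - C (b (n + 1)) * q n) :
    ∀ m, ((q (m + 2)).coeff (m + 1)) ^ 2 - 2 * (q (m + 2)).coeff m = ∑ i ∈ Finset.range (m + 2), a i ^ 2 + 2 * ∑ i ∈ Finset.range (m + 1), b (i + 1) := by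
  have hmd := recurrence_monic_natDegree hq0 hq1 hrec
  have hc1 := coeff_recurrence_sub_one hq0 hq1 hrec
  -- the recurrence for the second coefficient
  have hc2 : ∀ m, (q (m + 3)).coeff (m + 1) = (q (m + 2)).coeff m - a (m + 2) * (q (m + 2)).coeff (m + 1) - b (m + 2) := fun m => by
    have h1 : (q (m + 1)).coeff (m + 1) = 1 := by have := (hmd (m + 1)).1.coeff_natDegree; rwa [(hmd (m + 1)).2] at this
    rw [show m + 3 = (m + 1) + 2 by ring, hrec (m + 1), show m + 1 + 1 = m + 2 by ring, coeff_sub, sub_mul, coeff_sub, coeff_X_mul, coeff_C_mul, coeff_C_mul, h1, mul_one]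
  intro m
  induction m with
  | zero =>
    have h2 := hrec 0
    simp only [zero_add] at h2
    have hc10 : (q 2).coeff 1 = -(a 0 + a 1) := by
      have := hc1 1
      simp only [Nat.reduceAdd, Finset.sum_range_succ, Finset.sum_range_zero, zero_add] at this
      exact this
    have hc20 : (q 2).coeff 0 = a 0 * a 1 - b 1 := by
      rw [coeff_zero_eq_eval_zero, h2, hq1, hq0]
      simp only [eval_sub, eval_mul, eval_X, eval_C, eval_one]
      ring
    simp only [zero_add]
    rw [hc10, hc20]
    simp only [Finset.sum_range_succ, Finset.sum_range_zero, zero_add]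
    ring
  | succ m ih =>
    have e1 : (q (m + 2)).coeff (m + 1) = -∑ i ∈ Finset.range (m + 2), a i := hc1 (m + 1)
    have e2 : (q (m + 3)).coeff (m + 2) = -∑ i ∈ Finset.range (m + 3), a i := hc1 (m + 2)
    show ((q (m + 3)).coeff (m + 2)) ^ 2 - 2 * (q (m + 3)).coeff (m + 1) = ∑ i ∈ Finset.range (m + 3), a i ^ 2 + 2 * ∑ i ∈ Finset.range (m + 2), b (i + 1)
    rw [hc2 m, e2, e1]
    rw [e1] at ih
    simp only [Finset.sum_range_succ] at ih ⊢
    linear_combination ih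

/-- **The root multiset of `∏_{k : Fin n} (X − z_k)` is `{z_0, …, z_{n−1}}`.** [mechanism; this file, §1063] -/
theorem roots_prod_X_sub_C_fin {n : ℕ} (z : Fin n → ℝ) : (∏ k, (Polynomial.X - C (z k))).roots = (Finset.univ : Finset (Fin n)).val.map z := by
  rw [Finset.prod_eq_multiset_prod, show (Finset.univ : Finset (Fin n)).val.map (fun k => Polynomial.X - C (z k)) = ((Finset.univ : Finset (Fin n)).val.map z).map (fun x => Polynomial.X - C x) by
    rw [Multiset.map_map]; rfl, roots_multiset_prod_X_sub_C]

/-- **`Σ_k z_k = Σ_{i≤m} a_i`** when `q_{m+1} = ∏_k (X − z_k)`: the sum of the zeros of the `(m+1)`-st member of the recurrence is the sum of the first `m + 1` diagonal recurrence coefficients.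
[Chihara I (4.13); this file, §1063] -/
theorem sum_recurrence_zeros {q : ℕ → ℝ[X]} {a b : ℕ → ℝ} (hq0 : q 0 = 1) (hq1 : q 1 = Polynomial.X - C (a 0))
    (hrec : ∀ n, q (n + 2) = (Polynomial.X - C (a (n + 1))) * q (n + 1) - C (b (n + 1)) * q n) {m : ℕ} {z : Fin (m + 1) → ℝ}
    (hz : q (m + 1) = ∏ k, (Polynomial.X - C (z k))) : ∑ k, z k = ∑ i ∈ Finset.range (m + 1), a i := by
  have hmd := recurrence_monic_natDegree hq0 hq1 hrec (m + 1)
  have hroots : (q (m + 1)).roots = (Finset.univ : Finset (Fin (m + 1))).val.map z := by rw [hz, roots_prod_X_sub_C_fin]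
  have hcard : Multiset.card (q (m + 1)).roots = (q (m + 1)).natDegree := by
    rw [hroots, Multiset.card_map, Finset.card_val, Finset.card_univ, Fintype.card_fin, hmd.2]
  have h := Literature.Algebra.Polynomial.LaguerreRootBound.coeff_sub_one_eq_neg_sum_roots hmd.1 hcard (by rw [hmd.2]; omega)
  rw [hmd.2, Nat.add_sub_cancel, coeff_recurrence_sub_one hq0 hq1 hrec m, hroots, neg_inj] at h
  rw [h, ← Finset.sum_eq_multiset_sum]

/-- **`Σ_k z_k² = Σ_{i≤m+1} a_i² + 2 Σ_{i≤m} b_{i+1}`** when `q_{m+2} = ∏_k (X − z_k)` (second Newton sum). [Chihara I (4.14); this file, §1063] -/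
theorem sum_recurrence_zeros_sq {q : ℕ → ℝ[X]} {a b : ℕ → ℝ} (hq0 : q 0 = 1) (hq1 : q 1 = Polynomial.X - C (a 0))
    (hrec : ∀ n, q (n + 2) = (Polynomial.X - C (a (n + 1))) * q (n + 1) - C (b (n + 1)) * q n) {m : ℕ} {z : Fin (m + 2) → ℝ}
    (hz : q (m + 2) = ∏ k, (Polynomial.X - C (z k))) : ∑ k, z k ^ 2 = ∑ i ∈ Finset.range (m + 2), a i ^ 2 + 2 * ∑ i ∈ Finset.range (m + 1), b (i + 1) := by
  have hmd := recurrence_monic_natDegree hq0 hq1 hrec (m + 2)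
  have hroots : (q (m + 2)).roots = (Finset.univ : Finset (Fin (m + 2))).val.map z := by rw [hz, roots_prod_X_sub_C_fin]
  have hcard : Multiset.card (q (m + 2)).roots = (q (m + 2)).natDegree := by
    rw [hroots, Multiset.card_map, Finset.card_val, Finset.card_univ, Fintype.card_fin, hmd.2]
  have h := Literature.Algebra.Polynomial.LaguerreRootBound.sum_roots_sq_eq hmd.1 hcard (by rw [hmd.2]; omega)
  rw [hmd.2, show m + 2 - 1 = m + 1 by omega, show m + 2 - 2 = m by omega, coeff_recurrence_newton_two hq0 hq1 hrec m, hroots, Multiset.map_map, ← Finset.sum_eq_multiset_sum] at h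
  exact h

/-- **`tr J_m = a_0 + ⋯ + a_m`** for the Jacobi matrix `J_m` (N293). [Chihara IV §2; Gautschi §1.3; this file, §1063] -/
theorem trace_jacobi {a b : ℕ → ℝ} {m : ℕ} {J : Matrix (Fin (m + 1)) (Fin (m + 1)) ℝ}
    (hJ : ∀ i j : Fin (m + 1), J i j = if (i : ℕ) = j then a i else if (j : ℕ) = i + 1 then 1 else if (i : ℕ) = j + 1 then b i else 0) :
    J.trace = ∑ i ∈ Finset.range (m + 1), a i := by
  have h : ∀ i : Fin (m + 1), J i i = a i := fun i => by rw [hJ, if_pos rfl]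
  unfold Matrix.trace
  simp only [Matrix.diag_apply, h]
  exact Fin.sum_univ_eq_sum_range (fun i => a i) (m + 1)

/-- **`tr J_m² = Σ_{i≤m} a_i² + 2 Σ_{i<m} b_{i+1}`.** [Chihara I (4.14) ∕ IV §2; this file, §1063] -/
theorem trace_jacobi_sq {a b : ℕ → ℝ} {m : ℕ} {J : Matrix (Fin (m + 1)) (Fin (m + 1)) ℝ}
    (hJ : ∀ i j : Fin (m + 1), J i j = if (i : ℕ) = j then a i else if (j : ℕ) = i + 1 then 1 else if (i : ℕ) = j + 1 then b i else 0) :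
    (J * J).trace = ∑ i ∈ Finset.range (m + 1), a i ^ 2 + 2 * ∑ i ∈ Finset.range m, b (i + 1) := by
  -- the diagonal of `J²`
  have hdiag : ∀ i : Fin (m + 1), (J * J) i i = a i ^ 2 + (if (i : ℕ) + 1 < m + 1 then b (i + 1) else 0) + (if 0 < (i : ℕ) then b i else 0) := by
    intro i
    have hi := i.isLt
    rw [Matrix.mul_apply]
    simp only [hJ]
    rw [Fin.sum_univ_eq_sum_range (fun j : ℕ => (if (i : ℕ) = j then a i else if j = (i : ℕ) + 1 then 1 else if (i : ℕ) = j + 1 then b i else 0) *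
      (if j = (i : ℕ) then a j else if (i : ℕ) = j + 1 then 1 else if j = (i : ℕ) + 1 then b j else 0)) (m + 1)]
    have hsplit : ∀ j : ℕ, (if (i : ℕ) = j then a i else if j = (i : ℕ) + 1 then 1 else if (i : ℕ) = j + 1 then b i else 0) *
        (if j = (i : ℕ) then a j else if (i : ℕ) = j + 1 then 1 else if j = (i : ℕ) + 1 then b j else 0) =
        (if j = i then a i ^ 2 else 0) + (if j = (i : ℕ) + 1 then b (i + 1) else 0) + (if 0 < (i : ℕ) then (if j = (i : ℕ) - 1 then b i else 0) else 0) := fun j => by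
      by_cases h1 : (i : ℕ) = j
      · rw [if_pos h1, if_pos h1.symm, if_pos h1.symm, if_neg (by omega : ¬ j = (i : ℕ) + 1), ← h1]
        by_cases hp : 0 < (i : ℕ)
        · rw [if_pos hp, if_neg (by omega : ¬ (i : ℕ) = (i : ℕ) - 1)]; ring
        · rw [if_neg hp]; ring
      · rw [if_neg h1, if_neg (Ne.symm h1), if_neg (Ne.symm h1)]
        by_cases h2 : j = (i : ℕ) + 1
        · rw [if_pos h2, if_neg (by omega : ¬ (i : ℕ) = j + 1), if_pos h2, if_pos h2, h2]
          by_cases hp : 0 < (i : ℕ)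
          · rw [if_pos hp, if_neg (by omega : ¬ (i : ℕ) + 1 = (i : ℕ) - 1)]; ring
          · rw [if_neg hp]; ring
        · rw [if_neg h2, if_neg h2, if_neg h2]
          by_cases h3 : (i : ℕ) = j + 1
          · rw [if_pos h3, if_pos h3, if_pos (by omega : 0 < (i : ℕ)), if_pos (by omega : j = (i : ℕ) - 1)]; ring
          · rw [if_neg h3, if_neg h3]
            by_cases hp : 0 < (i : ℕ)
            · rw [if_pos hp, if_neg (by omega : ¬ j = (i : ℕ) - 1)]; ring
            · rw [if_neg hp]; ring
    simp only [hsplit]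
    rw [Finset.sum_add_distrib, Finset.sum_add_distrib, Finset.sum_ite_eq' (Finset.range (m + 1)), Finset.sum_ite_eq' (Finset.range (m + 1)),
      if_pos (Finset.mem_range.2 hi)]
    have h3 : ∑ j ∈ Finset.range (m + 1), (if 0 < (i : ℕ) then (if j = (i : ℕ) - 1 then b i else 0) else 0) = if 0 < (i : ℕ) then b i else 0 := by
      by_cases hp : 0 < (i : ℕ)
      · simp only [if_pos hp]
        rw [Finset.sum_ite_eq' (Finset.range (m + 1)), if_pos (Finset.mem_range.2 (by omega))]
      · simp only [if_neg hp, Finset.sum_const_zero]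
    rw [h3]
    by_cases hlast : (i : ℕ) + 1 < m + 1
    · rw [if_pos (Finset.mem_range.2 hlast), if_pos hlast]
    · rw [if_neg (fun h => hlast (Finset.mem_range.1 h)), if_neg hlast]
  unfold Matrix.trace
  simp only [Matrix.diag_apply, hdiag]
  rw [Fin.sum_univ_eq_sum_range (fun i : ℕ => a i ^ 2 + (if i + 1 < m + 1 then b (i + 1) else 0) + (if 0 < i then b i else 0)) (m + 1), Finset.sum_add_distrib,
    Finset.sum_add_distrib]
  -- `Σ_{i ≤ m} [i < m] b_{i+1} = Σ_{i < m} b_{i+1}` and `Σ_{i ≤ m} [0 < i] b_i = Σ_{i < m} b_{i+1}`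
  have hA : ∑ i ∈ Finset.range (m + 1), (if i + 1 < m + 1 then b (i + 1) else 0) = ∑ i ∈ Finset.range m, b (i + 1) := by
    rw [Finset.sum_range_succ, if_neg (lt_irrefl _), add_zero]
    exact Finset.sum_congr rfl fun i hi => if_pos (by have := Finset.mem_range.1 hi; omega)
  have hB : ∑ i ∈ Finset.range (m + 1), (if 0 < i then b i else 0) = ∑ i ∈ Finset.range m, b (i + 1) := by
    rw [Finset.sum_range_succ', if_neg (lt_irrefl 0), add_zero]
    exact Finset.sum_congr rfl fun i _ => if_pos (Nat.succ_pos i)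
  rw [hA, hB]
  ring

/-- **`det J_m = (−1)^{m+1} q_{m+1}(0)`.** [Gautschi §1.3; Horn–Johnson §0.9.10; this file, §1063] -/
theorem det_jacobi {q : ℕ → ℝ[X]} {a b : ℕ → ℝ} (hq0 : q 0 = 1) (hq1 : q 1 = Polynomial.X - C (a 0))
    (hrec : ∀ n, q (n + 2) = (Polynomial.X - C (a (n + 1))) * q (n + 1) - C (b (n + 1)) * q n) {m : ℕ} {J : Matrix (Fin (m + 1)) (Fin (m + 1)) ℝ}
    (hJ : ∀ i j : Fin (m + 1), J i j = if (i : ℕ) = j then a i else if (j : ℕ) = i + 1 then 1 else if (i : ℕ) = j + 1 then b i else 0) :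
    J.det = (-1 : ℝ) ^ (m + 1) * (q (m + 1)).eval 0 := by
  rw [Matrix.det_eq_sign_charpoly_coeff, Fintype.card_fin, charpoly_jacobi hq0 hq1 hrec hJ, coeff_zero_eq_eval_zero]

/-- **With the zeros: `det J_m = ∏_k z_k`, `tr J_m = Σ_k z_k`, `tr J_m² = Σ_k z_k²`** when `q_{m+1} = ∏_k (X − z_k)` (e.g. for a positive recurrence, N279; the eigenvalues of `J_m`, N293).
[Golub–Welsch 1969; Chihara I (4.13)–(4.14); this file, §1063] -/
theorem det_jacobi_eq_prod_zeros {q : ℕ → ℝ[X]} {a b : ℕ → ℝ} (hq0 : q 0 = 1) (hq1 : q 1 = Polynomial.X - C (a 0))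
    (hrec : ∀ n, q (n + 2) = (Polynomial.X - C (a (n + 1))) * q (n + 1) - C (b (n + 1)) * q n) {m : ℕ} {J : Matrix (Fin (m + 1)) (Fin (m + 1)) ℝ}
    (hJ : ∀ i j : Fin (m + 1), J i j = if (i : ℕ) = j then a i else if (j : ℕ) = i + 1 then 1 else if (i : ℕ) = j + 1 then b i else 0) {z : Fin (m + 1) → ℝ}
    (hz : q (m + 1) = ∏ k, (Polynomial.X - C (z k))) :
    J.det = ∏ k, z k ∧ J.trace = ∑ k, z k ∧ ∀ hm : 0 < m, (J * J).trace = ∑ k, z k ^ 2 := by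
  refine ⟨?_, ?_, fun hm => ?_⟩
  · rw [det_jacobi hq0 hq1 hrec hJ, hz, eval_prod]
    simp only [eval_sub, eval_X, eval_C, zero_sub]
    rw [Finset.prod_neg (fun k => z k), Finset.card_univ, Fintype.card_fin, ← mul_assoc, ← pow_add, ← two_mul, pow_mul, neg_one_sq, one_pow, one_mul]
  · rw [trace_jacobi hJ, sum_recurrence_zeros hq0 hq1 hrec hz]
  · obtain ⟨m', rfl⟩ : ∃ m', m = m' + 1 := ⟨m - 1, by omega⟩
    rw [trace_jacobi_sq hJ, sum_recurrence_zeros_sq hq0 hq1 hrec hz]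

end Summit.Ventures.HSemireg.Wedge.HankelOuter
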